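import Summits.RiemannHypothesis.RiemannHypothesis.Theorems.JensenLogBandArcModel
import Summits.RiemannHypothesis.RiemannHypothesis.Theorems.JensenLogBandArcDescentR2Kernel
import HarnessLib

/-!
# The φ-density, the Laplace main term and the shifted model of the right half-arc transform

RH ladder column JENSEN, rung J-P(P3) «log band», BAND crux `XiDerivBandRealAllRates` of route
«JensenLogBand», line «band-one-window» (u-arc, top-shell reshape), lead rh-jensen-prover g8 —
VOCABULARY for the assembly (S5) and the near zone (log-derivative transfer). RH-FREE definitions and
algebraic identities. WHAT THIS IS NOT: nothing here bears on zeros of `ζ` or the truth of RH.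

* `LogBandArc.arcDensity n c u = (u − c)·γ̃(½+u)·K_{n,c}(u)` — the φ-DENSITY of the `ζ`-free arc
  integrand as a function of the point: on the circle `u(φ) = c + r e^{iφ}`,
  `arcModelIntegrand n r c φ = i · arcDensity n c (u(φ))` (`arcModelIntegrand_eq_I_mul_arcDensity`);
  its logarithmic `u`-derivative is `arcSaddleFn n c` (by design of `LogBandArc.arcSaddleFn`).
* `LogBandArc.arcCurv n c u* = S′(u*)(u*−c)²/2` — the window curvature `w` of S4/S5.
* `LogBandArc.arcMainTerm n c u* = (n!/2π)·arcDensity n c u*·ζ(½+u*)·(π/w)^{1/2}` — the Laplace main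
  term of `U_{n,·}(c)` at its saddle `u*`; equals `(n!/2πi)·I(φ₀)·(π/w)^{1/2}·ζ(½+u*)`
  (`arcMainTerm_eq_integrand_form`), the form produced by `LogBandArc.arc_integral_saddleCircle_estimate`.
* `LogBandArc.arcShiftModel n v₀ u₀ v = (n!/2π)·arcDensity n v (u₀−v₀+v)·ζ(½+u₀−v₀+v)·(π/w₀)^{1/2}` —
  the TRANSLATED-SADDLE model about `(v₀, u₀)`: the main term with the saddle displaced rigidly with the
  centre and the curvature frozen; `arcShiftModel n v₀ u₀ v₀ = arcMainTerm n v₀ u₀`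
  (`arcShiftModel_self`). It is visibly holomorphic and zero-free in `v` (rational × `γ̃` × `ζ` right of
  the `1`-line), which is what the log-derivative transfer of the near zone
  (`LogBand.LogDerivTransfer.re_logDeriv_ge_of_norm_sub_le`) needs; `arcDensity_shift_eq` is its explicit
  rational form.
-/

noncomputable section

-- single-problem summit: `Summit.RiemannHypothesis.RiemannHypothesis.…` is the tree convention
set_option linter.dupNamespace false

open Complex Real

namespace Summit.RiemannHypothesis.RiemannHypothesis.Theorems.JensenPolynomials.LogBandArc

open Literature.NumberTheory.LFunctions

/-- The φ-density of the `ζ`-free arc integrand as a function of the point `u` (centre `c`):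
`P_{n,c}(u) = (u − c) · γ̃(½+u) · K_{n,c}(u)`. [folklore] -/
def arcDensity (n : ℕ) (c u : ℂ) : ℂ := (u - c) * (xiGammaFactor (1 / 2 + u) * sqKernel n c u)

/-- On the circle `u(φ) = c + r e^{iφ}`: `arcModelIntegrand n r c φ = i · arcDensity n c (u(φ))`.
[folklore] -/
theorem arcModelIntegrand_eq_I_mul_arcDensity (n : ℕ) (r : ℝ) (c : ℂ) (φ : ℝ) :
    arcModelIntegrand n r c φ = I * arcDensity n c (circleMap c r φ) := by
  rw [arcModelIntegrand, arcDensity, deriv_circleMap_eq_I_mul_sub]; ring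

/-- The window curvature `w = S′(u*)(u*−c)²/2` of the right half-arc about `c` at its saddle `u*`.
[folklore] -/
def arcCurv (n : ℕ) (c ustar : ℂ) : ℂ := deriv (arcSaddleFn n c) ustar * (ustar - c) ^ 2 / 2

/-- **The Laplace main term** of the right half-arc transform about `c` at its saddle `u*`:
`Main = (n!/2π) · P_{n,c}(u*) · ζ(½+u*) · (π/w)^{1/2}`, `w = arcCurv n c u*`. [folklore] -/
def arcMainTerm (n : ℕ) (c ustar : ℂ) : ℂ :=
  (n.factorial : ℂ) / (2 * π) *
    (arcDensity n c ustar * riemannZeta (1 / 2 + ustar) *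
      ((π : ℂ) / arcCurv n c ustar) ^ (1 / 2 : ℂ))

/-- The main term in the form produced by the saddle-circle estimate:
`Main = (n!/2πi) · I(φ₀) · (π/w)^{1/2} · ζ(½+u*)` with `I(φ₀) = arcModelIntegrand n ‖u*−c‖ c (arg(u*−c))`.
[folklore] -/
theorem arcMainTerm_eq_integrand_form (n : ℕ) (c ustar : ℂ) :
    arcMainTerm n c ustar = (n.factorial : ℂ) / (2 * π * I) *
      (arcModelIntegrand n ‖ustar - c‖ c (Complex.arg (ustar - c)) *
        ((π : ℂ) / arcCurv n c ustar) ^ (1 / 2 : ℂ) * riemannZeta (1 / 2 + ustar)) := by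
  rw [arcModelIntegrand_eq_I_mul_arcDensity, circleMap_norm_arg, arcMainTerm]
  have hπ : (2 * (π : ℂ)) ≠ 0 := by simp [Real.pi_ne_zero]
  field_simp

/-- The size of the main term: `‖Main‖ = (n!/2π)·‖P(u*)‖·‖ζ(½+u*)‖·(π/‖w‖)^{1/2}`. [folklore] -/
theorem norm_arcMainTerm (n : ℕ) (c ustar : ℂ) :
    ‖arcMainTerm n c ustar‖ = (n.factorial : ℝ) / (2 * π) *
      (‖arcDensity n c ustar‖ * ‖riemannZeta (1 / 2 + ustar)‖ *
        (π / ‖arcCurv n c ustar‖) ^ (1 / 2 : ℝ)) := by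
  rw [arcMainTerm, norm_mul, norm_mul, norm_mul, norm_div, Complex.norm_natCast]
  have h2π : ‖(2 * π : ℂ)‖ = 2 * π := by
    rw [norm_mul, Complex.norm_ofNat, Complex.norm_real, Real.norm_eq_abs, abs_of_pos Real.pi_pos]
  rw [h2π]
  congr 1
  congr 1
  -- the square root factor
  rcases eq_or_ne (arcCurv n c ustar) 0 with h0 | h0
  · rw [h0, div_zero, norm_zero, div_zero, Complex.zero_cpow (by norm_num), norm_zero,
      Real.zero_rpow (by norm_num)]
  · have hbase : ((π : ℂ) / arcCurv n c ustar) ≠ 0 :=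
      div_ne_zero (by exact_mod_cast Real.pi_ne_zero) h0
    rw [Complex.norm_cpow_of_ne_zero hbase, norm_div, Complex.norm_real, Real.norm_eq_abs,
      abs_of_pos Real.pi_pos]
    simp

/-- **The translated-saddle model** about `(v₀, u₀)`:
`M̃(v) = (n!/2π) · P_{n,v}(u₀ − v₀ + v) · ζ(½ + u₀ − v₀ + v) · (π/w₀)^{1/2}`, `w₀ = arcCurv n v₀ u₀` — the
main term with the saddle displaced rigidly with the centre and the curvature frozen. [folklore] -/
def arcShiftModel (n : ℕ) (v₀ u₀ v : ℂ) : ℂ :=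
  (n.factorial : ℂ) / (2 * π) *
    (arcDensity n v (u₀ - v₀ + v) * riemannZeta (1 / 2 + (u₀ - v₀ + v)) *
      ((π : ℂ) / arcCurv n v₀ u₀) ^ (1 / 2 : ℂ))

/-- At its own centre the shifted model is the main term. [folklore] -/
theorem arcShiftModel_self (n : ℕ) (v₀ u₀ : ℂ) : arcShiftModel n v₀ u₀ v₀ = arcMainTerm n v₀ u₀ := by
  simp [arcShiftModel, arcMainTerm]

/-- The explicit rational form of the density in the shifted model: with `ũ = u₀ − v₀ + v`,
`ũ − v = u₀ − v₀` and `ũ + v = u₀ − v₀ + 2v`, so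
`P_{n,v}(ũ) = (u₀−v₀) · γ̃(½+ũ) · 2ũ · ((u₀−v₀)(u₀−v₀+2v))^{−(n+1)}`. [folklore] -/
theorem arcDensity_shift_eq (n : ℕ) (v₀ u₀ v : ℂ) :
    arcDensity n v (u₀ - v₀ + v) =
      (u₀ - v₀) * (xiGammaFactor (1 / 2 + (u₀ - v₀ + v)) *
        (2 * (u₀ - v₀ + v) * (((u₀ - v₀) * (u₀ - v₀ + 2 * v)) ^ (n + 1))⁻¹)) := by
  rw [arcDensity, sqKernel]
  have h1 : u₀ - v₀ + v - v = u₀ - v₀ := by ring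
  have h2 : (u₀ - v₀ + v) ^ 2 - v ^ 2 = (u₀ - v₀) * (u₀ - v₀ + 2 * v) := by ring
  rw [h1, h2]

/-- The shifted model, fully explicit. [folklore] -/
theorem arcShiftModel_eq (n : ℕ) (v₀ u₀ v : ℂ) :
    arcShiftModel n v₀ u₀ v =
      (n.factorial : ℂ) / (2 * π) * ((u₀ - v₀) * (xiGammaFactor (1 / 2 + (u₀ - v₀ + v)) *
        (2 * (u₀ - v₀ + v) * (((u₀ - v₀) * (u₀ - v₀ + 2 * v)) ^ (n + 1))⁻¹)) *
        riemannZeta (1 / 2 + (u₀ - v₀ + v)) * ((π : ℂ) / arcCurv n v₀ u₀) ^ (1 / 2 : ℂ)) := by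
  rw [arcShiftModel, arcDensity_shift_eq]

end Summit.RiemannHypothesis.RiemannHypothesis.Theorems.JensenPolynomials.LogBandArc

end
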